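import Summits.MatrixMultiplication.OmegaCensus.STPPSmallPatternT1K10OrderLaw
import Summits.MatrixMultiplication.OmegaCensus.STPPSmallPatternEvenOrderLift
import Summits.MatrixMultiplication.OmegaCensus.STPPSmallPatternCyclicFatLifts

/-!
# ω-census, small pattern `(1,2,2)¹⁰`: even-order hosts from `140` — the fat lifts of the `(2,1,1)¹⁰` order-70 law (kernel)

Cell `pub-omega`, ω construction census, seat pub-omega ENG2 (gen 36). HONEST FRAMING (verbatim): lottery ticket; floor =
certified bounds/negative ranges.  Census STRUCTURE bookkeeping (row B5, column `T2` at `k = 10`; conjecture C10 (a) LIFT-TIGHT); nothing here bears on `ω`.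

The `T2` column of record at `k = 10` read «every finite abelian group of order `≥ 188` hosts `(1,2,2)¹⁰`» (stpp-3's all-abelian law).
The new `T1` law `exists_isSTPP_211pow10_of_card_ge_70` and the cyclic ray `exists_isSTPP_211pow10_zmod_of_le70` give, by the tree's lifts:

* `exists_isSTPP_122pow10_zmod_two_mul` — **`(1,2,2)¹⁰ ⊆ ℤ/2n` for every `n ≥ 70`**;
* `exists_isSTPP_122pow10_of_even_card_ge_140` — **every finite abelian group of EVEN order `≥ 140` hosts `(1,2,2)¹⁰`** (new for the even orders
  `140 … 186`);
* `exists_isSTPP_222pow10_of_four_dvd_card_ge_280` — every finite abelian group of order `≥ 280` divisible by `4` hosts `(2,2,2)¹⁰` (record: even `≥ 376`).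

References: H. Cohn, R. Kleinberg, B. Szegedy, C. Umans, FOCS 2005 (arXiv:math/0511460), Def. 5.1.  Seat pub-omega ENG2 (gen 36), 2026-08-29.
-/

open Literature.Computability.AlgebraicComplexity Finset

universe u

namespace Summit.MatrixMultiplication.OmegaCensus

/-- **`(1,2,2)¹⁰ ⊆ ℤ/2n` for every `n ≥ 70`** (fat lift of the cyclic `(2,1,1)¹⁰` ray from `70`). [cite: CohnKleinbergSzegedyUmans2005, Def. 5.1] -/
theorem exists_isSTPP_122pow10_zmod_two_mul (n : ℕ) (hn : 70 ≤ n) :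
    ∃ A B C : Fin 10 → Finset (ZMod (2 * n)), IsSTPP A B C ∧ ∀ i, (A i).card = 1 ∧ (B i).card = 2 ∧ (C i).card = 2 :=
  haveI : NeZero n := ⟨by omega⟩
  exists_isSTPP_122pow_zmod_two_mul_of_211pow (exists_isSTPP_211pow10_zmod_of_le70 n hn)

/-- **Every finite abelian group of even order `≥ 140` hosts `(1,2,2)¹⁰`** (even-order lift of the `(2,1,1)¹⁰` law at `70`).
[cite: CohnKleinbergSzegedyUmans2005, Def. 5.1] -/
theorem exists_isSTPP_122pow10_of_even_card_ge_140 {G : Type u} [AddCommGroup G] [Finite G] (heven : Even (Nat.card G))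
    (hG : 140 ≤ Nat.card G) :
    ∃ A B C : Fin 10 → Finset G, IsSTPP A B C ∧ ∀ i, (A i).card = 1 ∧ (B i).card = 2 ∧ (C i).card = 2 :=
  exists_isSTPP_122_of_even_card_of_law (N := 70) (fun Q _ _ hQ => exists_isSTPP_211pow10_of_card_ge_70 hQ) heven (by omega)

/-- Every finite abelian group of order `≥ 280` divisible by `4` hosts `(2,2,2)¹⁰` (double lift of the `(2,1,1)¹⁰` law at `70`).
[cite: CohnKleinbergSzegedyUmans2005, Def. 5.1] -/
theorem exists_isSTPP_222pow10_of_four_dvd_card_ge_280 {G : Type u} [AddCommGroup G] [Finite G] (h4 : 4 ∣ Nat.card G)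
    (hG : 280 ≤ Nat.card G) :
    ∃ A B C : Fin 10 → Finset G, IsSTPP A B C ∧ ∀ i, (A i).card = 2 ∧ (B i).card = 2 ∧ (C i).card = 2 :=
  exists_isSTPP_222_of_four_dvd_card_of_law (N := 70) (fun Q _ _ hQ => exists_isSTPP_211pow10_of_card_ge_70 hQ) h4 (by omega)

end Summit.MatrixMultiplication.OmegaCensus
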